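import Summits.FinalStateConjecture.FinalStateConjecture.Theses.PhaseMixingCapture
import Summits.FinalStateConjecture.FinalStateConjecture.Theorems.PhaseMixingCaptureWeakCosmicCensorshipMGHDStubScriTransfer
import Summits.FinalStateConjecture.FinalStateConjecture.Theorems.BulkKerrCaptureC2.Negative.BlockForm
import Literature.Geometry.Lorentzian.ConvergenceTransport
import Literature.Geometry.Lorentzian.InitialDataPullback
import Literature.Geometry.Lorentzian.StabilityCauchy
import HarnessLib

/-!
# Crux `PhaseMixingCapture.BulkKerrCaptureC2` (stmt-FinalStateConjecture-14985), line
# `bounded-kappa-closing-box` — the capture conclusion ASCENDS along embeddings of developments: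
# "one good vacuum Cauchy development per datum" suffices for `CaptureC2At` / `CaptureAt` / the crux

Support file (lead c7) for the line's open nonlinear stub `P = stub_packetClosingBoxC2`, whose
conclusion is the block `BulkKerrCapture.Negative.CaptureAt s δ 2 M _ ε C a`, and for the crux itself,
whose matrix is `BulkKerrCaptureC2.Negative.CaptureC2At` (`bulkKerrCaptureC2_iff_captureC2At`).  Both
blocks conclude, for EVERY MAXIMAL vacuum Cauchy development `𝒟` of a near-Kerr datum `D`, far-origin
completeness of `𝓘⁺` in Christodoulou's sojourn form (`DataEmbedding.HasCompleteFutureNullInfinityFar`)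
and `C²`-convergence of a region to a sub-extremal Kerr metric (`Spacetime.ConvergesToKerr`).  A
stability proof (bootstrap / Nash–Moser) never produces that directly: it constructs ONE development of
`D` with these properties.  This file proves, fact-free, that one is enough:

* `hasCompleteFutureNullInfinityFrom_of_embedsInto` — **restricted-origin sojourn completeness of `𝓘⁺`
  ascends along embeddings of data embeddings of the same datum** (`DataEmbedding.EmbedsInto`: smooth,
  isometric, time-orientation preserving open embedding `ψ` with `ψ ∘ ι₁ = ι₂`): a normalised null ray
  of the big development from `ι₂ p` restricts near its origin to `ψ ∘ γ'` with `γ'` a normalised null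
  ray of the small one from `p` (the landed lift `exists_isNormalisedNullRayFrom_lift` of the sibling
  crux `WeakCosmicCensorshipMGHD`, stub `stub_scriTransfer`, used with the identity sub-datum via
  `InitialDataSet.comap_eq_self_of_eq_id`); future completeness of `γ'` forces that of `γ`
  (`dom' ⊆ dom`), and the sojourn of `γ'` in `J⁺(ι₁ B₀)` is at most that of `γ` in `J⁺(ι₂ B₀)`
  (`ψ (J⁺(S)) ⊆ J⁺(ψ S)`, `LorentzianMetric.image_causalFuture_subset`).  Corollary
  `hasCompleteFutureNullInfinityFar_of_embedsInto` for data on the truncated Kerr–Schild slices.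
  (The all-origin case is the landed `hasCompleteNullInfinity_of_embedsInto`; DESCENT is false —
  time-truncated Minkowski embeds into Minkowski.)
* `isLateEmbedding_comp_image`, `convergesTo_comp_image`, `convergesToKerr_comp_image` — **late-time
  charts and `Cᵏ`-convergence to a model background push forward along isometric open embeddings**,
  the region becoming its image (surjectivity dropped from `Literature.ConvergenceTransport`'s
  `…comp_of_surjective`; the deviation is unchanged, `Spacetime.deviation_comp`); hence
  `convergesToKerr_of_embedsInto` for Cauchy developments.
* `captureC2At_of_forall_exists`, `captureAt_of_forall_exists` — **the blocks follow from the
  existence, for each datum in the ball, of ONE vacuum Cauchy development which is far-complete and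
  has a region converging to a sub-extremal Kerr metric with the required parameter bound**: every
  maximal development receives an embedding of it (`VacuumCauchyDevelopment.IsMaximal`), along which
  both conclusions ascend.  Conversely (`forall_exists_of_captureC2At`, `forall_exists_of_captureAt`)
  the blocks give back the existential form as soon as the data in the ball have maximal developments
  (Choquet-Bruhat–Geroch; taken as a hypothesis, no named fact is consumed).
* `bulkKerrCaptureC2_of_forall_exists` — the crux BY NAME from its existential form: to prove
  `BulkKerrCaptureC2` it suffices to construct, locally uniformly in the spin, one good development per
  near-Kerr b-conormal vacuum datum.  This is the exact shape in which Klainerman–Szeftel 2023 (|a| ≪ M)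
  and Hintz's sub-extremal claim (arXiv:2606.28253, Thm 13.1: a solution on `Ω = {𝔱 ≥ 0, r ≥ m₀}`)
  are printed, and the first reduction any proof of the stub `P` performs.

References: D. Christodoulou, CQG 16 (1999) A23, pp. A26–A27; M. Dafermos, I. Rodnianski,
arXiv:0811.0354, §2.6.2; B. O'Neill, *Semi-Riemannian geometry* (1983), Ch. 3, Prop. 3.24, pp. 90–91,
Ch. 14, pp. 402–403; M. Dafermos, G. Holzegel, I. Rodnianski, M. Taylor, arXiv:2104.08222, §1
(consequence form of convergence); Y. Choquet-Bruhat, R. Geroch, CMP 14 (1969), Thm 3.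
-/

-- the doubled `FinalStateConjecture.FinalStateConjecture` path component trips dupNamespace
set_option linter.dupNamespace false

noncomputable section

open Set Function Filter Topology
open scoped Manifold ContDiff Topology
open Literature.Geometry.Lorentzian
open Summit.FinalStateConjecture.FinalStateConjecture.Theses.PhaseMixingCapture (BulkKerrCaptureC2)
open Summit.FinalStateConjecture.FinalStateConjecture.Theorems.PhaseMixingCapture.WeakCosmicCensorshipMGHD
  (exists_isNormalisedNullRayFrom_lift)
open Summit.FinalStateConjecture.FinalStateConjecture.Theorems.BulkKerrCapture.Negative (CaptureAt)
open Summit.FinalStateConjecture.FinalStateConjecture.Theorems.BulkKerrCaptureC2.Negative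
  (CaptureC2At bulkKerrCaptureC2_iff_captureC2At)

namespace Summit.FinalStateConjecture.FinalStateConjecture.Theorems.BulkKerrCaptureC2.CaptureAscent

universe u

/-! ## §1 Late-time charts and convergence push forward along isometric open embeddings -/

section Convergence

variable {𝓢₀ 𝓢 : Spacetime.{u} 4} (B : ModelBackground)

/-- **Late-time embeddings push forward along isometric open embeddings, the region becoming its
image.**  If `Ψ` is a late-time embedding of the background `B` for the region `𝒟 ⊆ 𝓢₀` after time
`τ₀` and `φ : 𝓢₀ → 𝓢` is a smooth, time-orientation preserving, isometric open embedding, then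
`φ ∘ Ψ` is a late-time embedding for `φ '' 𝒟`: smoothness and openness compose, the late region is
mapped into `φ '' 𝒟`, and the covering clause `φ 𝒟 ∖ φΨ({t > τ₀}) ⊆ J⁻(φΨ({t = τ₀}))` is the image
of that of `Ψ` under `φ (J⁻(S)) ⊆ J⁻(φ S)` (`LorentzianMetric.image_causalPast_subset`).  Surjectivity
(as in `Spacetime.IsLateEmbedding.comp_of_surjective`) is not needed.  DHRT arXiv:2104.08222, §1.
-- adapted from Cruxes/CaptureSuffices/SketchIdeator1.lean (`IsLateEmbedding.comp_image`) -/
theorem isLateEmbedding_comp_image {𝒟 : Set 𝓢₀.carrier} {τ₀ : ℝ} {Ψ : B.domain → 𝓢₀.carrier}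
    (hΨ : 𝓢₀.IsLateEmbedding B 𝒟 τ₀ Ψ) {φ : 𝓢₀.carrier → 𝓢.carrier}
    (hφs : ContMDiff (𝓡 4) (𝓡 4) ∞ φ) (hopen : IsOpenEmbedding φ)
    (hφ : ∀ y, pullbackBilin (I := 𝓡 4) (I' := 𝓡 4) φ 𝓢.metric.val y = 𝓢₀.metric.val y)
    (hτ : 𝓢₀.timeOrientation.PreservesTimeOrientation φ 𝓢.timeOrientation) :
    𝓢.IsLateEmbedding B (φ '' 𝒟) τ₀ (φ ∘ Ψ) where
  contMDiff := hφs.comp hΨ.contMDiff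
  isOpenEmbedding := hopen.comp hΨ.isOpenEmbedding
  image_subset := by
    rw [image_comp]
    exact image_mono hΨ.image_subset
  diff_subset_causalPast := by
    rintro x ⟨⟨x₀, hx₀𝒟, rfl⟩, hx⟩
    have hx₀ : x₀ ∉ Ψ '' B.lateRegion τ₀ := fun ⟨z, hz, hzx⟩ ↦ hx ⟨z, hz, by simp [← hzx]⟩
    have h := hΨ.diff_subset_causalPast ⟨hx₀𝒟, hx₀⟩
    have h' := LorentzianMetric.image_causalPast_subset (hφs.mdifferentiable (by simp)) hτ hφ
      (Ψ '' B.timeSlab τ₀)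
    rw [image_comp]
    exact h' (mem_image_of_mem φ h)

/-- **`Cᵏ`-convergence to a background pushes forward along isometric open embeddings** (the region
becomes its image): the late chart `φ ∘ Ψ` has the SAME deviation function as `Ψ`
(`Spacetime.deviation_comp`: `(φ ∘ Ψ)^* g − g₀ = Ψ^* (φ^* g) − g₀`).  DHRT arXiv:2104.08222, §1.
-- adapted from Cruxes/CaptureSuffices/SketchIdeator1.lean (`ConvergesTo.comp_image`) -/
theorem convergesTo_comp_image {𝒟 : Set 𝓢₀.carrier} {k : ℕ} (h : 𝓢₀.ConvergesTo B 𝒟 k)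
    {φ : 𝓢₀.carrier → 𝓢.carrier} (hφs : ContMDiff (𝓡 4) (𝓡 4) ∞ φ) (hopen : IsOpenEmbedding φ)
    (hφ : ∀ y, pullbackBilin (I := 𝓡 4) (I' := 𝓡 4) φ 𝓢.metric.val y = 𝓢₀.metric.val y)
    (hτ : 𝓢₀.timeOrientation.PreservesTimeOrientation φ 𝓢.timeOrientation) :
    𝓢.ConvergesTo B (φ '' 𝒟) k := by
  obtain ⟨τ₀, Ψ, hΨ, ht⟩ := h
  refine ⟨τ₀, φ ∘ Ψ, isLateEmbedding_comp_image B hΨ hφs hopen hφ hτ, ?_⟩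
  have hdev : 𝓢.deviationCk B (φ ∘ Ψ) k = 𝓢₀.deviationCk B Ψ k := by
    funext τ
    unfold Spacetime.deviationCk Spacetime.deviationExtend
    rw [Spacetime.deviation_comp B (hφs.mdifferentiable (by simp)) hφ
      (hΨ.contMDiff.mdifferentiable (by simp))]
  rw [hdev]
  exact ht

/-- **`Cᵏ`-convergence to the Kerr metric `g_{M,a}` pushes forward along isometric open embeddings**
(`convergesTo_comp_image` for `Kerr.background M a`).  DHRT arXiv:2104.08222, §1. -/
theorem convergesToKerr_comp_image {𝒟 : Set 𝓢₀.carrier} {M a : ℝ} {k : ℕ}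
    (h : 𝓢₀.ConvergesToKerr 𝒟 M a k)
    {φ : 𝓢₀.carrier → 𝓢.carrier} (hφs : ContMDiff (𝓡 4) (𝓡 4) ∞ φ) (hopen : IsOpenEmbedding φ)
    (hφ : ∀ y, pullbackBilin (I := 𝓡 4) (I' := 𝓡 4) φ 𝓢.metric.val y = 𝓢₀.metric.val y)
    (hτ : 𝓢₀.timeOrientation.PreservesTimeOrientation φ 𝓢.timeOrientation) :
    𝓢.ConvergesToKerr (φ '' 𝒟) M a k :=
  convergesTo_comp_image (Kerr.background M a) h hφs hopen hφ hτ

end Convergence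

/-! ## §2 Ascent along embeddings of developments of the same datum -/

section Ascent

variable {X : Type u} [TopologicalSpace X] [ChartedSpace E3 X] [IsManifold (𝓡 3) ∞ X]
  [ConnectedSpace X] {D : InitialDataSet (𝓡 3) X}

/-- **Restricted-origin sojourn completeness of `𝓘⁺` ascends along embeddings of data embeddings of
the same datum.**  If `𝒮₁ ↪ 𝒮₂` (`DataEmbedding.EmbedsInto`) and `𝒮₁` has complete future null
infinity as seen from the origins `A ⊆ X` (`DataEmbedding.HasCompleteFutureNullInfinityFrom`), then so
has `𝒮₂`, with the same compact sets `B₀`, `B₁`: a normalised null ray `γ : dom` of `𝒮₂` from `ι₂ p`,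
`p ∈ A ∖ B₁`, restricts on some `dom' ⊆ dom` to `ψ ∘ γ'` with `γ'` a normalised null ray of `𝒮₁` from
`p` (`exists_isNormalisedNullRayFrom_lift` with the identity sub-datum, `D.comap id = D`); if `γ'` is
future complete so is `γ`, and the sojourn of `γ'` in `J⁺(ι₁ B₀)` is at most that of `γ` in
`J⁺(ι₂ B₀)` because `ψ (J⁺(S)) ⊆ J⁺(ψ S)` (`LorentzianMetric.image_causalFuture_subset`) and
`ψ ∘ ι₁ = ι₂`.  Christodoulou, CQG 16 (1999) A23, pp. A26–A27; Dafermos–Rodnianski arXiv:0811.0354,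
§2.6.2; O'Neill 1983, Ch. 3, pp. 90–91, Ch. 14, pp. 402–403. -/
theorem hasCompleteFutureNullInfinityFrom_of_embedsInto {𝒮₁ 𝒮₂ : DataEmbedding D}
    (h : 𝒮₁.EmbedsInto 𝒮₂) (A : Set X) (h₁ : 𝒮₁.HasCompleteFutureNullInfinityFrom A) :
    𝒮₂.HasCompleteFutureNullInfinityFrom A := by
  have hΦ : ContMDiff (𝓡 3) (𝓡 3) (∞ + 1) (id : X → X) := contMDiff_id
  have hΦ' : ∀ u : X, Function.Injective (mfderiv (𝓡 3) (𝓡 3) (id : X → X) u) := fun u ↦ by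
    rw [mfderiv_id]
    exact fun v w hvw ↦ hvw
  obtain ⟨ψ, hψs, hψo, hψi, hψt, hψe⟩ := h
  -- the lift lemma is typed over a sub-datum `D.comap Φ`; generalise that binder to a name `D'`
  have key : ∀ (D' : InitialDataSet (𝓡 3) X), D.comap id hΦ hΦ' = D' →
      ∀ (𝒮 : DataEmbedding D') (χ : 𝒮.carrier → 𝒮₂.carrier),
        ContMDiff (𝓡 4) (𝓡 4) ∞ χ →
        𝒮.metric.IsIsometricImmersion 𝒮₂.metric.toPseudoRiemannianMetric χ →
        𝒮.timeOrientation.PreservesTimeOrientation χ 𝒮₂.timeOrientation →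
        χ ∘ 𝒮.embed = 𝒮₂.embed ∘ id →
        𝒮.HasCompleteFutureNullInfinityFrom A → 𝒮₂.HasCompleteFutureNullInfinityFrom A := by
    intro D' e
    subst e
    intro 𝒮 χ hχ hiso hτ hcomm H hLC₂
    haveI : 𝒮₂.metric.HasLeviCivita := hLC₂
    haveI : 𝒮.metric.HasLeviCivita := 𝒮.metric.toPseudoRiemannianMetric.hasLeviCivita
    have hχd : MDifferentiable (𝓡 4) (𝓡 4) χ := hχ.mdifferentiable (by simp)
    obtain ⟨B₀, hB₀, hH⟩ := H
    refine ⟨B₀, hB₀, fun s hs ↦ ?_⟩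
    obtain ⟨B₁, hB₁, hH₁⟩ := hH s hs
    refine ⟨B₁, hB₁, fun p hpA hpB γ dom hγ ↦ ?_⟩
    -- lift the ray to `𝒮`
    obtain ⟨γ', dom', hγ', hdom, hagree⟩ :=
      exists_isNormalisedNullRayFrom_lift 𝒮₂ 𝒮 hχ hiso hτ hcomm hγ
    rcases hH₁ p hpA hpB γ' dom' hγ' with h | h
    · exact Or.inl fun hb ↦ h (hb.mono hdom)
    · refine Or.inr (h.trans (MeasureTheory.measure_mono fun t ht ↦ ⟨hdom ht.1, ht.2.1, ?_⟩))
      -- `χ (J⁺_𝒮(ι₁ B₀)) ⊆ J⁺_{𝒮₂}(ι₂ B₀)`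
      rw [← hagree t ht.1]
      refine LorentzianMetric.causalFuture_mono ?_
        (LorentzianMetric.image_causalFuture_subset hχd hτ hiso.2 _ (mem_image_of_mem χ ht.2.2))
      rintro _ ⟨_, ⟨q, hq, rfl⟩, rfl⟩
      exact ⟨q, hq, (congrFun hcomm q).symm⟩
  -- `𝒮₂.HasCompleteFutureNullInfinityFrom A` binds the Levi-Civita instance of `𝒮₂`; introduce it
  -- first, so that the trailing instance binder of `key …`'s conclusion is discharged by it
  intro hLC₂
  exact key D (D.comap_eq_self_of_eq_id hΦ hΦ' rfl) 𝒮₁ ψ hψs hψi hψt (by rw [hψe]; rfl) h₁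

/-- **`Cᵏ`-convergence to Kerr ascends along embeddings of Cauchy developments of the same datum**:
if `𝒟₁ ↪ 𝒟₂` and a region `𝒟oc ⊆ 𝒟₁` converges in `Cᵏ` to `g_{M,a}`, then the region `ψ '' 𝒟oc`
of `𝒟₂` does (`convergesToKerr_comp_image`).  DHRT arXiv:2104.08222, §1. -/
theorem convergesToKerr_of_embedsInto {𝒟₁ 𝒟₂ : CauchyDevelopment D} (h : 𝒟₁.EmbedsInto 𝒟₂)
    {𝒟oc : Set 𝒟₁.carrier} {M a : ℝ} {k : ℕ} (hc : 𝒟₁.toSpacetime.ConvergesToKerr 𝒟oc M a k) :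
    ∃ 𝒟oc' : Set 𝒟₂.carrier, 𝒟₂.toSpacetime.ConvergesToKerr 𝒟oc' M a k := by
  obtain ⟨ψ, hψs, hψo, hψi, hψt, -⟩ := h
  exact ⟨ψ '' 𝒟oc, convergesToKerr_comp_image hc hψs hψo hψi.2 hψt⟩

end Ascent

/-! ## §3 Far-origin completeness on the truncated Kerr–Schild slices, and the capture blocks -/

section Blocks

/-- **Far-origin sojourn completeness ascends along embeddings** of data embeddings of a datum on the
truncated Kerr–Schild slice `Kerr.slice a r₀` (`DataEmbedding.HasCompleteFutureNullInfinityFar` =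
`HasCompleteFutureNullInfinityFrom (range (Kerr.farSliceIncl a r₀))`).  Dafermos–Rodnianski
arXiv:0811.0354, §2.6.2. -/
theorem hasCompleteFutureNullInfinityFar_of_embedsInto [Kerr.SliceFacts] {a r₀ : ℝ}
    {D : InitialDataSet 𝓘(ℝ, E3) (Kerr.slice a r₀)} {𝒮₁ 𝒮₂ : DataEmbedding D}
    (h : 𝒮₁.EmbedsInto 𝒮₂) (h₁ : 𝒮₁.HasCompleteFutureNullInfinityFar) :
    𝒮₂.HasCompleteFutureNullInfinityFar :=
  hasCompleteFutureNullInfinityFrom_of_embedsInto h _ h₁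

/-- **`CaptureC2At` from ONE good development per datum.**  If every b-conormal vacuum-constraint
solution `D` on `Kerr.slice a M` within `H^s_δ`-distance `ε` of `Kerr.data M a M` has SOME vacuum
Cauchy development which is far-complete and has a region converging in `C²` to a sub-extremal
`g_{M',a'}` with `|M' − M| + |a' − a| ≤ η`, then `CaptureC2At s δ M _ ε η a` holds: every maximal
development of `D` receives an embedding of the good one (`VacuumCauchyDevelopment.IsMaximal`), along
which far-completeness and convergence ascend. -/
theorem captureC2At_of_forall_exists [Kerr.Facts] [Kerr.SliceFacts] {s : ℕ} {δ M : ℝ} {hM : 0 ≤ M}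
    {ε η a : ℝ}
    (H : ∀ (D : InitialDataSet 𝓘(ℝ, E3) (Kerr.slice a M)) [D.metric.HasLeviCivita],
      D.IsVacuumConstraintSolution →
      (∀ s' : ℕ, InitialDataSet.dataWeightedSobolevEDist s' δ D (Kerr.data M a M hM) < ⊤) →
      InitialDataSet.dataWeightedSobolevEDist s δ D (Kerr.data M a M hM) < ENNReal.ofReal ε →
      ∃ (𝒟₀ : VacuumCauchyDevelopment D) (M' a' : ℝ) (𝒟oc : Set 𝒟₀.carrier),
        Kerr.IsSubextremal M' a' ∧ 𝒟₀.HasCompleteFutureNullInfinityFar ∧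
        𝒟₀.toSpacetime.ConvergesToKerr 𝒟oc M' a' 2 ∧ |M' - M| + |a' - a| ≤ η) :
    CaptureC2At s δ M hM ε η a := by
  intro D _ hvac hcon hdist 𝒟 hmax
  obtain ⟨𝒟₀, M', a', 𝒟oc, hsub, hfar, hconv, hpar⟩ := H D hvac hcon hdist
  have hemb : 𝒟₀.toCauchyDevelopment.EmbedsInto 𝒟.toCauchyDevelopment := hmax 𝒟₀
  obtain ⟨𝒟oc', hconv'⟩ := convergesToKerr_of_embedsInto hemb hconv
  exact ⟨M', a', 𝒟oc', hsub, hasCompleteFutureNullInfinityFar_of_embedsInto hemb hfar, hconv', hpar⟩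

/-- **Converse, given maximal developments**: if every datum in the ball has a maximal vacuum Cauchy
development (Choquet-Bruhat–Geroch, CMP 14 (1969), Thm 3 — taken as a hypothesis), `CaptureC2At`
gives back the existential form (the MGHD itself is the good development). -/
theorem forall_exists_of_captureC2At [Kerr.Facts] [Kerr.SliceFacts] {s : ℕ} {δ M : ℝ} {hM : 0 ≤ M}
    {ε η a : ℝ} (h : CaptureC2At s δ M hM ε η a)
    (hMGHD : ∀ (D : InitialDataSet 𝓘(ℝ, E3) (Kerr.slice a M)) [D.metric.HasLeviCivita],
      D.IsVacuumConstraintSolution →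
      InitialDataSet.dataWeightedSobolevEDist s δ D (Kerr.data M a M hM) < ENNReal.ofReal ε →
      ∃ 𝒟 : VacuumCauchyDevelopment D, 𝒟.IsMaximal) :
    ∀ (D : InitialDataSet 𝓘(ℝ, E3) (Kerr.slice a M)) [D.metric.HasLeviCivita],
      D.IsVacuumConstraintSolution →
      (∀ s' : ℕ, InitialDataSet.dataWeightedSobolevEDist s' δ D (Kerr.data M a M hM) < ⊤) →
      InitialDataSet.dataWeightedSobolevEDist s δ D (Kerr.data M a M hM) < ENNReal.ofReal ε →
      ∃ (𝒟₀ : VacuumCauchyDevelopment D) (M' a' : ℝ) (𝒟oc : Set 𝒟₀.carrier),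
        Kerr.IsSubextremal M' a' ∧ 𝒟₀.HasCompleteFutureNullInfinityFar ∧
        𝒟₀.toSpacetime.ConvergesToKerr 𝒟oc M' a' 2 ∧ |M' - M| + |a' - a| ≤ η := by
  intro D _ hvac hcon hdist
  obtain ⟨𝒟, hmax⟩ := hMGHD D hvac hdist
  obtain ⟨M', a', 𝒟oc, hsub, hfar, hconv, hpar⟩ := h D hvac hcon hdist 𝒟 hmax
  exact ⟨𝒟, M', a', 𝒟oc, hsub, hfar, hconv, hpar⟩

/-- **`CaptureAt` (the conclusion of the line's stub `P = stub_packetClosingBoxC2`, i.e. the strong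
form `StrongCaptureTwo` at one spin) from ONE good development per datum**: if every vacuum-constraint
solution `D` in the bare `H^s_δ`-ball of radius `ε` about `Kerr.data M a M` has SOME vacuum Cauchy
development which is far-complete and has a region converging in `Cᵏ` to a sub-extremal `g_{M',a'}`
with `|M' − M| + |a' − a| ≤ C √dist`, then `CaptureAt s δ k M _ ε C a`. -/
theorem captureAt_of_forall_exists [Kerr.Facts] [Kerr.SliceFacts] {s : ℕ} {δ : ℝ} {k : ℕ} {M : ℝ}
    {hM : 0 ≤ M} {ε C a : ℝ}
    (H : ∀ (D : InitialDataSet 𝓘(ℝ, E3) (Kerr.slice a M)) [D.metric.HasLeviCivita],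
      D.IsVacuumConstraintSolution →
      InitialDataSet.dataWeightedSobolevEDist s δ D (Kerr.data M a M hM) < ENNReal.ofReal ε →
      ∃ (𝒟₀ : VacuumCauchyDevelopment D) (M' a' : ℝ) (𝒟oc : Set 𝒟₀.carrier),
        Kerr.IsSubextremal M' a' ∧ 𝒟₀.HasCompleteFutureNullInfinityFar ∧
        𝒟₀.toSpacetime.ConvergesToKerr 𝒟oc M' a' k ∧
        |M' - M| + |a' - a| ≤
          C * √(InitialDataSet.dataWeightedSobolevEDist s δ D (Kerr.data M a M hM)).toReal) :
    CaptureAt s δ k M hM ε C a := by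
  intro D _ hvac hdist 𝒟 hmax
  obtain ⟨𝒟₀, M', a', 𝒟oc, hsub, hfar, hconv, hpar⟩ := H D hvac hdist
  have hemb : 𝒟₀.toCauchyDevelopment.EmbedsInto 𝒟.toCauchyDevelopment := hmax 𝒟₀
  obtain ⟨𝒟oc', hconv'⟩ := convergesToKerr_of_embedsInto hemb hconv
  exact ⟨M', a', 𝒟oc', hsub, hasCompleteFutureNullInfinityFar_of_embedsInto hemb hfar, hconv', hpar⟩

/-- **Converse for `CaptureAt`, given maximal developments** (Choquet-Bruhat–Geroch as a hypothesis). -/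
theorem forall_exists_of_captureAt [Kerr.Facts] [Kerr.SliceFacts] {s : ℕ} {δ : ℝ} {k : ℕ} {M : ℝ}
    {hM : 0 ≤ M} {ε C a : ℝ} (h : CaptureAt s δ k M hM ε C a)
    (hMGHD : ∀ (D : InitialDataSet 𝓘(ℝ, E3) (Kerr.slice a M)) [D.metric.HasLeviCivita],
      D.IsVacuumConstraintSolution →
      InitialDataSet.dataWeightedSobolevEDist s δ D (Kerr.data M a M hM) < ENNReal.ofReal ε →
      ∃ 𝒟 : VacuumCauchyDevelopment D, 𝒟.IsMaximal) :
    ∀ (D : InitialDataSet 𝓘(ℝ, E3) (Kerr.slice a M)) [D.metric.HasLeviCivita],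
      D.IsVacuumConstraintSolution →
      InitialDataSet.dataWeightedSobolevEDist s δ D (Kerr.data M a M hM) < ENNReal.ofReal ε →
      ∃ (𝒟₀ : VacuumCauchyDevelopment D) (M' a' : ℝ) (𝒟oc : Set 𝒟₀.carrier),
        Kerr.IsSubextremal M' a' ∧ 𝒟₀.HasCompleteFutureNullInfinityFar ∧
        𝒟₀.toSpacetime.ConvergesToKerr 𝒟oc M' a' k ∧
        |M' - M| + |a' - a| ≤
          C * √(InitialDataSet.dataWeightedSobolevEDist s δ D (Kerr.data M a M hM)).toReal := by
  intro D _ hvac hdist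
  obtain ⟨𝒟, hmax⟩ := hMGHD D hvac hdist
  obtain ⟨M', a', 𝒟oc, hsub, hfar, hconv, hpar⟩ := h D hvac hdist 𝒟 hmax
  exact ⟨𝒟, M', a', 𝒟oc, hsub, hfar, hconv, hpar⟩

/-- **Registered sub-goal `stub_captureAt_of_forall_exists`** (crux item stmt-FinalStateConjecture-14985,
line `bounded-kappa-closing-box`): the conclusion `CaptureAt s δ k M _ ε C a` of the line's open stub
`P = stub_packetClosingBoxC2` (at `k = 2`) follows from ONE good vacuum Cauchy development per datum
in the ball — closed form of `captureAt_of_forall_exists`, all parameters explicit. -/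
theorem stub_captureAt_of_forall_exists : ∀ [Kerr.Facts] [Kerr.SliceFacts] (s : ℕ) (δ : ℝ) (k : ℕ) (M : ℝ) (hM : 0 ≤ M) (ε C a : ℝ), (∀ (D : InitialDataSet 𝓘(ℝ, E3) (Kerr.slice a M)) [D.metric.HasLeviCivita], D.IsVacuumConstraintSolution → InitialDataSet.dataWeightedSobolevEDist s δ D (Kerr.data M a M hM) < ENNReal.ofReal ε → ∃ (𝒟₀ : VacuumCauchyDevelopment D) (M' a' : ℝ) (𝒟oc : Set 𝒟₀.carrier), Kerr.IsSubextremal M' a' ∧ 𝒟₀.HasCompleteFutureNullInfinityFar ∧ 𝒟₀.toSpacetime.ConvergesToKerr 𝒟oc M' a' k ∧ |M' - M| + |a' - a| ≤ C * √(InitialDataSet.dataWeightedSobolevEDist s δ D (Kerr.data M a M hM)).toReal) → CaptureAt s δ k M hM ε C a :=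
  fun s δ k M hM ε C a H ↦ captureAt_of_forall_exists (s := s) (δ := δ) (k := k) (M := M) (hM := hM)
    (ε := ε) (C := C) (a := a) H

/-- **Registered sub-goal `stub_captureC2At_of_forall_exists`** (crux item stmt-FinalStateConjecture-14985,
line `bounded-kappa-closing-box`): the crux block `CaptureC2At s δ M _ ε η a`
(`bulkKerrCaptureC2_iff_captureC2At`) follows from ONE good vacuum Cauchy development per b-conormal
datum in the ball — closed form of `captureC2At_of_forall_exists`, all parameters explicit. -/
theorem stub_captureC2At_of_forall_exists : ∀ [Kerr.Facts] [Kerr.SliceFacts] (s : ℕ) (δ M : ℝ) (hM : 0 ≤ M) (ε η a : ℝ), (∀ (D : InitialDataSet 𝓘(ℝ, E3) (Kerr.slice a M)) [D.metric.HasLeviCivita], D.IsVacuumConstraintSolution → (∀ s' : ℕ, InitialDataSet.dataWeightedSobolevEDist s' δ D (Kerr.data M a M hM) < ⊤) → InitialDataSet.dataWeightedSobolevEDist s δ D (Kerr.data M a M hM) < ENNReal.ofReal ε → ∃ (𝒟₀ : VacuumCauchyDevelopment D) (M' a' : ℝ) (𝒟oc : Set 𝒟₀.carrier), Kerr.IsSubextremal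 M' a' ∧ 𝒟₀.HasCompleteFutureNullInfinityFar ∧ 𝒟₀.toSpacetime.ConvergesToKerr 𝒟oc M' a' 2 ∧ |M' - M| + |a' - a| ≤ η) → CaptureC2At s δ M hM ε η a :=
  fun s δ M hM ε η a H ↦ captureC2At_of_forall_exists (s := s) (δ := δ) (M := M) (hM := hM) (ε := ε)
    (η := η) (a := a) H

end Blocks

/-! ## §4 The crux from its existential form -/

/-- **`BulkKerrCaptureC2` from ONE good development per datum, locally uniformly in the spin.**  To
prove the crux it suffices to produce, for every `a₁ < 1`, exponents `(s, δ)` and, per mass `M > 0`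
and tolerance `η > 0`, a basin `ε > 0` such that for every `|a| ≤ a₁ M` every b-conormal vacuum datum
`D` in the `H^s_δ`-ball of radius `ε` about `Kerr.data M a M` has SOME vacuum Cauchy development with
far-complete `𝓘⁺` (sojourn form) and a region converging in `C²` to a sub-extremal `g_{M',a'}`,
`|M' − M| + |a' − a| ≤ η` (`captureC2At_of_forall_exists` through the block form
`bulkKerrCaptureC2_iff_captureC2At`).  This is the printed shape of the stability theorems the crux
imports (Klainerman–Szeftel 2023, Thm 1.2.1; Hintz arXiv:2606.28253, Thm 13.1). -/
theorem bulkKerrCaptureC2_of_forall_exists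
    (H : ∀ [Kerr.Facts] [Kerr.SliceFacts], ∀ a₁ : ℝ, a₁ < 1 → ∃ (s : ℕ) (δ : ℝ),
      ∀ (M : ℝ) (hM : 0 < M), ∀ η > (0 : ℝ), ∃ ε > (0 : ℝ), ∀ a : ℝ, |a| ≤ a₁ * M →
        ∀ (D : InitialDataSet 𝓘(ℝ, E3) (Kerr.slice a M)) [D.metric.HasLeviCivita],
          D.IsVacuumConstraintSolution →
          (∀ s' : ℕ, InitialDataSet.dataWeightedSobolevEDist s' δ D (Kerr.data M a M hM.le) < ⊤) →
          InitialDataSet.dataWeightedSobolevEDist s δ D (Kerr.data M a M hM.le) <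
            ENNReal.ofReal ε →
          ∃ (𝒟₀ : VacuumCauchyDevelopment D) (M' a' : ℝ) (𝒟oc : Set 𝒟₀.carrier),
            Kerr.IsSubextremal M' a' ∧ 𝒟₀.HasCompleteFutureNullInfinityFar ∧
            𝒟₀.toSpacetime.ConvergesToKerr 𝒟oc M' a' 2 ∧ |M' - M| + |a' - a| ≤ η) :
    BulkKerrCaptureC2 := by
  rw [bulkKerrCaptureC2_iff_captureC2At]
  intro _ _ a₁ ha₁
  obtain ⟨s, δ, h⟩ := H a₁ ha₁
  refine ⟨s, δ, fun M hM η hη ↦ ?_⟩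
  obtain ⟨ε, hε, h'⟩ := h M hM η hη
  exact ⟨ε, hε, fun a ha ↦ captureC2At_of_forall_exists (h' a ha)⟩

end Summit.FinalStateConjecture.FinalStateConjecture.Theorems.BulkKerrCaptureC2.CaptureAscent

end
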